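import Mathlib.Algebra.Group.Irreducible.Lemmas
import Mathlib.Algebra.Group.Equiv.TypeTags
import Literature.AlgebraicGeometry.Frobenioids.ArithmeticFrobenioids
import HarnessLib

/-!
# Frobenioids I, Thm. 6.4 (iii)/(iv): a monoid isomorphism `Φ₁(L₁) ⥲ Φ₂(L₂)` of effective arithmetic divisor
# monoids is a bijection of places — finite to finite, "generator ↦ generator", archimedean to archimedean

Mochizuki, *The geometry of Frobenioids I: the general theory*, Kyushu J. Math. **62** (2008) 293–400, §6,
Thm. 6.4 (iii) p. 115 l. 3–9 ("the bijection `V(L₁) ⥲ Prime(Φ₁(L₁)) ⥲ Prime(Φ₂(L₂)) ⥲ V(L₂)` induced by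
`(Ψ^pf)^un-tr` [cf. (i); Corollary 4.11, (iii)]") and Thm. 6.4 (iv), proof p. 116 l. 25–29 ("`deg^arith_{L_i}`
maps a generator of the monoid `Φ_i(L_i)_{v_i} (≅ ℤ_{≥0})` to `log(p)`" — i.e. the monoid isomorphism
`Ψ^Φ : Φ₁(L₁) ⥲ Φ₂(L₂)` lying over `Ψ` (Thm. 4.9 / Cor. 4.11 (iii)) carries THE GENERATOR at `v₁` to THE
GENERATOR at `v₂`) [cite: MochizukiFrdI2008, Thm. 6.4 (iv) p.116].

PROOF-ONLY file (cell abc-iut, sub-DAG `plan/L1/SUBDAG-FrdI-Thm64.md` row **T64iv/L01**, field "generator ↦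
generator" of the transport datum of an equivalence `Ψ : C₁ ⥲ C₂` of arithmetic Frobenioids; L1-lead R108 (4)
row (G); seat abc-iut-L1-d7).  PURE MONOID ALGEBRA over abc-iut-L1-t3's `EffArithDivisor L =
(FinitePlace L →₀ ℕ) × (InfinitePlace L → ℝ≥0)` (`ArithmeticDivisors.lean`), no Frobenioid input: for ANY
additive (resp. multiplicative, on `Multiplicative (EffArithDivisor _)` = the carrier of the divisor monoid
`Φ(Spec L)` of `C_{K/F}`, `arithFrobenioidOps_mon`) isomorphism `e : Φ(L₁) ⥲ Φ(L₂)`: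
* the additively irreducible elements ("atoms") of `Φ(L)` are exactly the generators `δ_w = (single w 1, 0)` at
  the FINITE places (an archimedean coordinate `t ∈ ℝ_{≥0}` splits as `t/2 + t/2`) — `addIrreducible_iff`;
* hence `e` induces a UNIQUE bijection `π : FinitePlace L₁ ≃ FinitePlace L₂` with `e δ_w = δ_{π w}`
  (`exists_finitePlaceEquiv`, `finitePlaceEquiv_unique`);
* the archimedean part `{D | D.1 = 0}` is the set of elements below no atom, so `e` maps it onto the
  archimedean part, and `e (f, t) = (π_* f, g t)` for an additive bijection `g` of the archimedean parts
  (`exists_decomposition`);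
* multiplicative wrappers for `e : Multiplicative (EffArithDivisor L₁) ≃* Multiplicative (EffArithDivisor L₂)`
  in the letter of `EffArithDivisor.single` / `Ex63_primes` (`exists_finitePlaceEquiv_mulEquiv`, …).
No definitions, no named facts; nothing here bears on [IUTchIII] Cor. 3.12 or asserts anything about abc.
-/

noncomputable section

namespace Literature.AlgebraicGeometry.Frobenioids

namespace EffArithDivisor

open NumberField

variable {L : Type*} [Field L] [NumberField L]

/-! ### Units and atoms of `Φ(L)` -/

/-- `Φ(L)` is sharp: its only additive unit is `0`. [cite: MochizukiFrdI2008, Ex. 6.3 p.113] -/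
theorem isAddUnit_iff_eq_zero {D : EffArithDivisor L} : IsAddUnit D ↔ D = 0 := by
  refine ⟨fun h => ?_, fun h => h ▸ isAddUnit_zero⟩
  obtain ⟨u, rfl⟩ := h
  have h0 : (u : EffArithDivisor L) + ↑(-u) = 0 := u.add_neg
  have h1 : (u : EffArithDivisor L).1 = 0 := Finsupp.ext fun w => by
    have hw := congrArg (fun D : EffArithDivisor L => D.1 w) h0
    simp only [Prod.fst_add, Finsupp.coe_add, Pi.add_apply, Prod.fst_zero, Finsupp.coe_zero,
      Pi.zero_apply] at hw
    rw [Finsupp.coe_zero, Pi.zero_apply]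
    omega
  have h2 : (u : EffArithDivisor L).2 = 0 := funext fun v => by
    have hv := congrArg (fun D : EffArithDivisor L => D.2 v) h0
    simp only [Prod.snd_add, Pi.add_apply, Prod.snd_zero, Pi.zero_apply] at hv
    exact (add_eq_zero.mp hv).1
  exact Prod.ext h1 h2

/-- The generator `δ_w = (single w 1, 0)` at a finite place determines the place.
[cite: MochizukiFrdI2008, Ex. 6.3 p.113] -/
theorem single_finite_injective :
    Function.Injective fun w : FinitePlace L => ((Finsupp.single w 1, 0) : EffArithDivisor L) := by
  intro w w' h
  have h1 : Finsupp.single w (1 : ℕ) = Finsupp.single w' 1 := congrArg Prod.fst h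
  exact Finsupp.single_left_injective one_ne_zero h1

/-- **The atoms of `Φ(L)`**: an effective arithmetic divisor is additively irreducible iff it is the generator
`δ_w = (single w 1, 0)` of the factor `ord(O_w^▷) ≅ ℤ_{≥0}` at a FINITE place `w` (the archimedean factors
`ord(O_v^▷) ≅ ℝ_{≥0}` are divisible: `t = t/2 + t/2`). [cite: MochizukiFrdI2008, Thm. 6.4 (iv) p.116] -/
theorem addIrreducible_iff {D : EffArithDivisor L} :
    AddIrreducible D ↔ ∃ w : FinitePlace L, D = (Finsupp.single w 1, 0) := by
  constructor
  · intro hD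
    -- the archimedean part vanishes: otherwise `D = (D.1, D.2/2) + (0, D.2/2)` with two non-units
    have h2 : D.2 = 0 := by
      by_contra hne
      obtain ⟨v, hv⟩ : ∃ v, D.2 v ≠ 0 := Function.ne_iff.mp hne
      have hsplit : D = ((D.1, fun v => D.2 v / 2) : EffArithDivisor L) + (0, fun v => D.2 v / 2) := by
        refine Prod.ext ?_ (funext fun v' => ?_)
        · simp
        · simp only [Prod.snd_add, Pi.add_apply, add_halves]
      rcases hD.isAddUnit_or_isAddUnit hsplit with h | h
      · have := congrArg (fun E : EffArithDivisor L => E.2 v) (isAddUnit_iff_eq_zero.mp h)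
        simp only [Prod.snd_zero, Pi.zero_apply, div_eq_zero_iff, OfNat.ofNat_ne_zero, or_false] at this
        exact hv this
      · have := congrArg (fun E : EffArithDivisor L => E.2 v) (isAddUnit_iff_eq_zero.mp h)
        simp only [Prod.snd_zero, Pi.zero_apply, div_eq_zero_iff, OfNat.ofNat_ne_zero, or_false] at this
        exact hv this
    -- the finite part is a single generator
    have h1 : D.1 ≠ 0 := by
      intro h
      exact hD.not_isAddUnit (isAddUnit_iff_eq_zero.mpr (Prod.ext h h2))
    obtain ⟨w, hw⟩ : ∃ w, D.1 w ≠ 0 := by simpa using DFunLike.ne_iff.mp h1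
    have hle : Finsupp.single w 1 ≤ D.1 := Finsupp.single_le_iff.mpr (Nat.one_le_iff_ne_zero.mpr hw)
    have hsplit : D = ((Finsupp.single w 1, 0) : EffArithDivisor L) + (D.1 - Finsupp.single w 1, 0) := by
      refine Prod.ext ?_ ?_
      · simp only [Prod.fst_add]
        exact (add_tsub_cancel_of_le hle).symm
      · simp [h2]
    refine ⟨w, ?_⟩
    rcases hD.isAddUnit_or_isAddUnit hsplit with h | h
    · exact absurd (congrArg Prod.fst (isAddUnit_iff_eq_zero.mp h)) (by simp)
    · rw [hsplit, isAddUnit_iff_eq_zero.mp h, add_zero]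
  · rintro ⟨w, rfl⟩
    refine ⟨fun h => ?_, fun a b hab => ?_⟩
    · exact absurd (congrArg Prod.fst (isAddUnit_iff_eq_zero.mp h)) (by simp)
    · -- `δ_w = a + b`: the archimedean parts vanish and one of the finite parts vanishes
      have h2 : a.2 = 0 ∧ b.2 = 0 := by
        have := congrArg Prod.snd hab
        simp only [Prod.snd_add] at this
        constructor
        · funext v; have hv := congrFun this v; simp only [Pi.zero_apply, Pi.add_apply] at hv
          exact (add_eq_zero.mp hv.symm).1
        · funext v; have hv := congrFun this v; simp only [Pi.zero_apply, Pi.add_apply] at hv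
          exact (add_eq_zero.mp hv.symm).2
      have h1 : a.1 + b.1 = Finsupp.single w 1 := by
        have := congrArg Prod.fst hab
        simpa using this.symm
      -- off `w` both finite parts vanish
      have hoff : ∀ w', w' ≠ w → a.1 w' = 0 ∧ b.1 w' = 0 := fun w' hw' => by
        have := DFunLike.congr_fun h1 w'
        simp only [Finsupp.coe_add, Pi.add_apply, Finsupp.single_eq_of_ne hw'] at this
        omega
      have hat : a.1 w + b.1 w = 1 := by
        have := DFunLike.congr_fun h1 w
        simpa using this
      by_cases ha : a.1 w = 0
      · -- then `a.1 = 0`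
        left
        have ha1 : a.1 = 0 := Finsupp.ext fun w' => by
          rw [Finsupp.coe_zero, Pi.zero_apply]
          by_cases hw' : w' = w
          · rw [hw']; exact ha
          · exact (hoff w' hw').1
        exact isAddUnit_iff_eq_zero.mpr (Prod.ext ha1 h2.1)
      · right
        have hb1 : b.1 = 0 := Finsupp.ext fun w' => by
          rw [Finsupp.coe_zero, Pi.zero_apply]
          by_cases hw' : w' = w
          · rw [hw']; omega
          · exact (hoff w' hw').2
        exact isAddUnit_iff_eq_zero.mpr (Prod.ext hb1 h2.2)

/-- The finite part of an effective arithmetic divisor vanishes iff no atom lies below it (`D ≠ δ_w + C`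
for every finite `w` and every `C`): the archimedean part of `Φ(L)` characterised inside the monoid.
[cite: MochizukiFrdI2008, Thm. 6.4 (iii) p.115] -/
theorem fst_eq_zero_iff_forall {D : EffArithDivisor L} :
    D.1 = 0 ↔ ∀ (w : FinitePlace L) (C : EffArithDivisor L), D ≠ (Finsupp.single w 1, 0) + C := by
  constructor
  · rintro h w C rfl
    have := DFunLike.congr_fun h w
    simp only [Prod.fst_add, Finsupp.coe_add, Pi.add_apply, Finsupp.single_eq_same, Finsupp.coe_zero,
      Pi.zero_apply] at this
    omega
  · intro h
    by_contra hne
    obtain ⟨w, hw⟩ : ∃ w, D.1 w ≠ 0 := by simpa using DFunLike.ne_iff.mp hne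
    have hle : Finsupp.single w 1 ≤ D.1 := Finsupp.single_le_iff.mpr (Nat.one_le_iff_ne_zero.mpr hw)
    refine h w (D.1 - Finsupp.single w 1, D.2) (Prod.ext ?_ ?_)
    · simp only [Prod.fst_add]
      exact (add_tsub_cancel_of_le hle).symm
    · simp

variable {L₁ : Type*} [Field L₁] [NumberField L₁] {L₂ : Type*} [Field L₂] [NumberField L₂]

/-! ### An isomorphism of divisor monoids is a bijection of finite places, generator to generator -/

/-- An additive isomorphism `Φ(L₁) ⥲ Φ(L₂)` carries each finite-place generator `δ_w` to a finite-place
generator (atoms to atoms). [cite: MochizukiFrdI2008, Thm. 6.4 (iv) p.116] -/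
theorem exists_map_single_eq (e : EffArithDivisor L₁ ≃+ EffArithDivisor L₂) (w : FinitePlace L₁) :
    ∃ w' : FinitePlace L₂, e (Finsupp.single w 1, 0) = (Finsupp.single w' 1, 0) :=
  addIrreducible_iff.mp ((AddEquiv.addIrreducible_iff e).mpr (addIrreducible_iff.mpr ⟨w, rfl⟩))

/-- **"Generator ↦ generator"** (Thm. 6.4 (iv), proof p. 116 l. 25–29; the bijection of Thm. 6.4 (iii)
p. 115): an additive isomorphism `e : Φ(L₁) ⥲ Φ(L₂)` of effective arithmetic divisor monoids induces a bijection
`π : 𝕍(L₁)^non ≃ 𝕍(L₂)^non` of FINITE places with `e δ_w = δ_{π w}` for every finite place `w`.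
[cite: MochizukiFrdI2008, Thm. 6.4 (iv) p.116] -/
theorem exists_finitePlaceEquiv (e : EffArithDivisor L₁ ≃+ EffArithDivisor L₂) :
    ∃ π : FinitePlace L₁ ≃ FinitePlace L₂,
      ∀ w, e (Finsupp.single w 1, 0) = (Finsupp.single (π w) 1, 0) := by
  choose f hf using exists_map_single_eq e
  choose g hg using exists_map_single_eq e.symm
  have hgf : ∀ w, g (f w) = w := fun w => by
    apply single_finite_injective
    change ((Finsupp.single (g (f w)) 1, 0) : EffArithDivisor L₁) = (Finsupp.single w 1, 0)
    rw [← hg, ← hf, AddEquiv.symm_apply_apply]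
  have hfg : ∀ w', f (g w') = w' := fun w' => by
    apply single_finite_injective
    change ((Finsupp.single (f (g w')) 1, 0) : EffArithDivisor L₂) = (Finsupp.single w' 1, 0)
    rw [← hf, ← hg, AddEquiv.apply_symm_apply]
  exact ⟨⟨f, g, hgf, hfg⟩, hf⟩

/-- The bijection of finite places with `e δ_w = δ_{π w}` is UNIQUE (so any two transports built from the same
monoid isomorphism — e.g. through `Prime(Φ(L)) ≃ V(L)`, Ex. 6.3 — agree on finite places).
[cite: MochizukiFrdI2008, Thm. 6.4 (iii) p.115] -/
theorem finitePlaceEquiv_unique (e : EffArithDivisor L₁ ≃+ EffArithDivisor L₂)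
    {π π' : FinitePlace L₁ → FinitePlace L₂}
    (hπ : ∀ w, e (Finsupp.single w 1, 0) = (Finsupp.single (π w) 1, 0))
    (hπ' : ∀ w, e (Finsupp.single w 1, 0) = (Finsupp.single (π' w) 1, 0)) : π = π' :=
  funext fun w => single_finite_injective ((hπ w).symm.trans (hπ' w))

/-- Along such a `π`, `e` acts on the finite part of a finitely supported divisor by push-forward:
`e (f, 0) = (π_* f, 0)`. [cite: MochizukiFrdI2008, Thm. 6.4 (iv) p.116] -/
theorem map_fst_eq_equivMapDomain (e : EffArithDivisor L₁ ≃+ EffArithDivisor L₂)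
    {π : FinitePlace L₁ ≃ FinitePlace L₂} (hπ : ∀ w, e (Finsupp.single w 1, 0) = (Finsupp.single (π w) 1, 0))
    (f : FinitePlace L₁ →₀ ℕ) : e (f, 0) = (Finsupp.equivMapDomain π f, 0) := by
  induction f using Finsupp.induction with
  | zero =>
    rw [Finsupp.equivMapDomain_zero]
    exact map_zero e
  | single_add w n f _ _ ih =>
    have hsplit : ((Finsupp.single w n + f, 0) : EffArithDivisor L₁) = n • (Finsupp.single w 1, 0) + (f, 0) := by
      refine Prod.ext ?_ ?_
      · simp only [Prod.fst_add, Prod.smul_fst, Finsupp.smul_single, smul_eq_mul, mul_one]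
      · simp
    rw [hsplit, map_add, map_nsmul, hπ, ih]
    refine Prod.ext ?_ ?_
    · simp only [Prod.fst_add, Prod.smul_fst, Finsupp.smul_single, smul_eq_mul, mul_one,
        Finsupp.equivMapDomain_eq_mapDomain, Finsupp.mapDomain_add, Finsupp.mapDomain_single]
    · simp

/-- An additive isomorphism of divisor monoids maps the archimedean part `{D | D.1 = 0}` of `Φ(L₁)` onto the
archimedean part of `Φ(L₂)` (archimedean ↦ archimedean, Thm. 6.4 (iii) p. 115 "`v₀` of `ℚ`" with `v₀ = ∞`).
[cite: MochizukiFrdI2008, Thm. 6.4 (iii) p.115] -/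
theorem map_fst_eq_zero_iff (e : EffArithDivisor L₁ ≃+ EffArithDivisor L₂) (D : EffArithDivisor L₁) :
    (e D).1 = 0 ↔ D.1 = 0 := by
  obtain ⟨π, hπ⟩ := exists_finitePlaceEquiv e
  rw [fst_eq_zero_iff_forall, fst_eq_zero_iff_forall]
  constructor
  · rintro h w C rfl
    exact h (π w) (e C) (by rw [map_add, hπ])
  · rintro h w' C' hC'
    refine h (π.symm w') (e.symm C') ?_
    apply e.injective
    rw [map_add, hπ, Equiv.apply_symm_apply, AddEquiv.apply_symm_apply]
    exact hC'

/-- **Structure of an isomorphism of effective arithmetic divisor monoids**: `e (f, t) = (π_* f, g t)` for the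
bijection `π` of finite places ("generator ↦ generator") and an additive bijection `g` of the archimedean parts
`(V(L₁)^arc → ℝ_{≥0}) ⥲ (V(L₂)^arc → ℝ_{≥0})`. [cite: MochizukiFrdI2008, Thm. 6.4 (iv) p.116] -/
theorem exists_decomposition (e : EffArithDivisor L₁ ≃+ EffArithDivisor L₂) :
    ∃ (π : FinitePlace L₁ ≃ FinitePlace L₂) (g : (InfinitePlace L₁ → NNReal) ≃+ (InfinitePlace L₂ → NNReal)),
      (∀ w, e (Finsupp.single w 1, 0) = (Finsupp.single (π w) 1, 0)) ∧
        ∀ D : EffArithDivisor L₁, e D = (Finsupp.equivMapDomain π D.1, g D.2) := by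
  obtain ⟨π, hπ⟩ := exists_finitePlaceEquiv e
  have h0 : ∀ t : InfinitePlace L₁ → NNReal, (e (0, t)).1 = 0 := fun t => (map_fst_eq_zero_iff e _).mpr rfl
  have h0' : ∀ t : InfinitePlace L₂ → NNReal, (e.symm (0, t)).1 = 0 := fun t =>
    (map_fst_eq_zero_iff e.symm _).mpr rfl
  have he : ∀ t, e (0, t) = (0, (e (0, t)).2) := fun t => Prod.ext (h0 t) rfl
  have he' : ∀ t, e.symm (0, t) = (0, (e.symm (0, t)).2) := fun t => Prod.ext (h0' t) rfl
  let g : (InfinitePlace L₁ → NNReal) ≃+ (InfinitePlace L₂ → NNReal) :=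
    { toFun := fun t => (e (0, t)).2
      invFun := fun t => (e.symm (0, t)).2
      left_inv := fun t => by
        change (e.symm (0, (e (0, t)).2)).2 = t
        rw [← he, AddEquiv.symm_apply_apply]
      right_inv := fun t => by
        change (e (0, (e.symm (0, t)).2)).2 = t
        rw [← he', AddEquiv.apply_symm_apply]
      map_add' := fun s t => by
        rw [← Prod.snd_add, ← map_add, Prod.mk_add_mk, add_zero] }
  refine ⟨π, g, hπ, fun D => ?_⟩
  have hD : D = ((D.1, 0) : EffArithDivisor L₁) + (0, D.2) := by ext <;> simp
  rw [hD, map_add, map_fst_eq_equivMapDomain e hπ, he]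
  ext <;> simp [g]

end EffArithDivisor

/-! ### Multiplicative form (the divisor monoid `Φ(Spec L) = Multiplicative (EffArithDivisor L)` of `C_{K/F}`) -/

namespace EffArithDivisor

open NumberField

variable {L₁ : Type} [Field L₁] [NumberField L₁] {L₂ : Type} [Field L₂] [NumberField L₂]

/-- The generator `δ_w` in the letter of `EffArithDivisor.single` (Ex. 6.3's `Prime(Φ(L)) ≃ V(L)`, finite place).
[cite: MochizukiFrdI2008, Ex. 6.3 p.113] -/
theorem single_inr (L : Type) [Field L] [NumberField L] (w : FinitePlace L) :
    EffArithDivisor.single L (Sum.inr w) = (Finsupp.single w 1, 0) := rfl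

/-- **"Generator ↦ generator", multiplicative form**: a monoid isomorphism
`e : Φ(L₁) = Multiplicative (EffArithDivisor L₁) ⥲ Φ(L₂)` (e.g. the component `Ψ^Φ_X` of Cor. 4.11 (iii) /
Thm. 4.9 at `X = Spec L₁` for an equivalence `Ψ` of arithmetic Frobenioids) induces a bijection of finite
places `π` with `e δ_w = δ_{π w}`. [cite: MochizukiFrdI2008, Thm. 6.4 (iv) p.116] -/
theorem exists_finitePlaceEquiv_mulEquiv
    (e : Multiplicative (EffArithDivisor L₁) ≃* Multiplicative (EffArithDivisor L₂)) :
    ∃ π : FinitePlace L₁ ≃ FinitePlace L₂,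
      ∀ w, e (Multiplicative.ofAdd (EffArithDivisor.single L₁ (Sum.inr w))) =
        Multiplicative.ofAdd (EffArithDivisor.single L₂ (Sum.inr (π w))) := by
  obtain ⟨π, hπ⟩ := exists_finitePlaceEquiv (AddEquiv.toMultiplicative.symm e)
  refine ⟨π, fun w => ?_⟩
  have h := hπ w
  rw [single_inr, single_inr]
  exact congrArg Multiplicative.ofAdd h

/-- Uniqueness of `π`, multiplicative form. [cite: MochizukiFrdI2008, Thm. 6.4 (iii) p.115] -/
theorem finitePlaceEquiv_unique_mulEquiv
    (e : Multiplicative (EffArithDivisor L₁) ≃* Multiplicative (EffArithDivisor L₂))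
    {π π' : FinitePlace L₁ → FinitePlace L₂}
    (hπ : ∀ w, e (Multiplicative.ofAdd (EffArithDivisor.single L₁ (Sum.inr w))) =
      Multiplicative.ofAdd (EffArithDivisor.single L₂ (Sum.inr (π w))))
    (hπ' : ∀ w, e (Multiplicative.ofAdd (EffArithDivisor.single L₁ (Sum.inr w))) =
      Multiplicative.ofAdd (EffArithDivisor.single L₂ (Sum.inr (π' w)))) : π = π' :=
  funext fun w => single_finite_injective (Multiplicative.ofAdd.injective ((hπ w).symm.trans (hπ' w)))

/-- Structure theorem, multiplicative form: `e (ofAdd (f, t)) = ofAdd (π_* f, g t)`.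
[cite: MochizukiFrdI2008, Thm. 6.4 (iv) p.116] -/
theorem exists_decomposition_mulEquiv
    (e : Multiplicative (EffArithDivisor L₁) ≃* Multiplicative (EffArithDivisor L₂)) :
    ∃ (π : FinitePlace L₁ ≃ FinitePlace L₂) (g : (InfinitePlace L₁ → NNReal) ≃+ (InfinitePlace L₂ → NNReal)),
      (∀ w, e (Multiplicative.ofAdd (EffArithDivisor.single L₁ (Sum.inr w))) =
          Multiplicative.ofAdd (EffArithDivisor.single L₂ (Sum.inr (π w)))) ∧
        ∀ D : EffArithDivisor L₁,
          e (Multiplicative.ofAdd D) = Multiplicative.ofAdd (Finsupp.equivMapDomain π D.1, g D.2) := by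
  obtain ⟨π, g, hπ, hD⟩ := exists_decomposition (AddEquiv.toMultiplicative.symm e)
  refine ⟨π, g, fun w => ?_, fun D => ?_⟩
  · rw [single_inr, single_inr]
    exact congrArg Multiplicative.ofAdd (hπ w)
  · exact congrArg Multiplicative.ofAdd (hD D)

end EffArithDivisor

end Literature.AlgebraicGeometry.Frobenioids

end
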